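import Summits.Ventures.WeilGRH.UniformConductorFloorCellsBudget
import HarnessLib

/-!
# GRH arm (rh-explicit, venture WeilGRH): the digamma Lorentzian in position space and the sharpened archimedean bound

Cell `rh-explicit`, WEIL TRACK — GRH ARM (weil-grh-1).  `UniformConductorFloor.lean` bounds the archimedean form from
below by keeping one term of the vertical series of `Re ψ`, `Re ψ(x + iτ/2) ≥ ψ(x) + 1/x − x/(x² + τ²/4)`, and pays the
Lorentzian DEFICIT `D_x(g) = (1/2π)∫|ĝ(1/2+iτ)|² x/(x²+τ²/4) dτ` with the pointwise bound `|ĝ|² ≤ 2t‖g‖₂²`, i.e.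
`D_x(g) ≤ 2t‖g‖₂²`.  Here the deficit is moved to position space:

* `∫ e^{−a|u|} cos(τu) du = 2a/(a² + τ²)` (`integral_exp_neg_mul_abs_mul_cos`), so `x/(x²+τ²/4)` is the cosine transform
  of `e^{−2x|u|}`, and by Fubini and Mellin inversion for `k = g ⋆ g̃`
  (`weilMellin_inversion`), **`D_x(g) = ∫ e^{−2x|u|} Re k(u) du`** (`lorentz_deficit_eq_integral`);
* `|k(u)| ≤ ∫|g(y)||g(y−u)| dy`, `2|g(y)||g(y')| ≤ |g(y)|² + |g(y')|²` restricted to the window, Fubini, and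
  `∫_{y−t}^{y+t} e^{−a|u|} du ≤ (2/a)(1 − e^{−at})` for `|y| < t` (the centred window is the largest) give
  **`D_x(g) ≤ (1/x)(1 − e^{−2xt})‖g‖₂²`** (`lorentz_deficit_le`);
* hence the archimedean bound with the GAIN `e^{−2xt}/x` in place of `1/x − 2t`
  (`arch_lower_bound_lorentz`: `(ψ(x) + e^{−2xt}/x)‖g‖₂² ≤ (1/2π)∫|ĝ|² Re ψ(x + iτ/2)`), and the floor theorem
  `weilPositivityOnChar_of_phi_budget_lorentz`: `log π − ψ(x) − γ + ρ ≤ log q ⇒ WeilPositivityOnChar χ t` for any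
  `γ ≤ e^{−2xt}/x` and any cell certificate `ρ` for the primes (`UniformConductorFloorCellsBudget.lean`).

At `t = 1` the gain is `4e^{−1/2} = 2.426` (even) instead of `2`, and `(4/3)e^{−3/2} = 0.2975` (odd) instead of `0`.

## References

* A. Weil (1952), (11) with (5), (10) [Weil1952FormulesExplicites]; E. Bombieri (2000), §2 (Mellin inversion) [Bombieri2000Weil];
  H. L. Montgomery, R. C. Vaughan (2007), (12.22) (position form of the archimedean term) [MontgomeryVaughan2007].
-/

noncomputable section

open Complex Filter Set MeasureTheory
open scoped Real Topology ComplexConjugate ArithmeticFunction.vonMangoldt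

namespace Summit.Ventures.WeilGRH

open Literature.NumberTheory.LFunctions

namespace UniformFloor

variable {g : ℝ → ℂ}

/-! ## The cosine transform of `e^{−a|u|}` -/

/-- `∫₀^∞ e^{−av} cos(τv) dv = a/(a² + τ²)` for `a > 0` (real part of `∫₀^∞ e^{(−a+iτ)v} dv = 1/(a − iτ)`). [folklore] -/
theorem integral_Ioi_exp_neg_mul_cos {a : ℝ} (ha : 0 < a) (τ : ℝ) :
    ∫ v in Ioi (0 : ℝ), Real.exp (-(a * v)) * Real.cos (τ * v) = a / (a ^ 2 + τ ^ 2) := by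
  set z : ℂ := -a + τ * I with hz
  have hzre : z.re < 0 := by simp [hz, ha]
  have hint := integral_exp_mul_complex_Ioi hzre 0
  have hI := integrableOn_exp_mul_complex_Ioi hzre 0
  have hre : ∀ v : ℝ, (cexp (z * v)).re = Real.exp (-(a * v)) * Real.cos (τ * v) := by
    intro v
    rw [Complex.exp_re]
    congr 2
    · simp [hz]
    · simp [hz]
  have h1 : ∫ v in Ioi (0 : ℝ), Real.exp (-(a * v)) * Real.cos (τ * v) =
      (∫ v in Ioi (0 : ℝ), cexp (z * v)).re := by
    have h := integral_re hI
    simp only [RCLike.re_to_complex] at h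
    rw [← h]
    exact setIntegral_congr_fun measurableSet_Ioi fun v _ ↦ (hre v).symm
  rw [h1, hint]
  simp only [Complex.ofReal_zero, mul_zero, Complex.exp_zero]
  have hz0 : z ≠ 0 := fun h ↦ by rw [h] at hzre; simp at hzre
  rw [show (-1 : ℂ) / z = -z⁻¹ by rw [div_eq_mul_inv, neg_one_mul], Complex.neg_re, Complex.inv_re,
    show z.re = -a by simp [hz], show Complex.normSq z = a ^ 2 + τ ^ 2 by
      rw [hz, show (-(a : ℂ) + τ * I) = ((-a : ℝ) : ℂ) + τ * I by push_cast; ring, Complex.normSq_add_mul_I]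
      ring]
  ring

/-- **`∫ e^{−a|u|} cos(τu) du = 2a/(a² + τ²)`** for `a > 0`. [folklore] -/
theorem integral_exp_neg_mul_abs_mul_cos {a : ℝ} (ha : 0 < a) (τ : ℝ) :
    ∫ u : ℝ, Real.exp (-(a * |u|)) * Real.cos (τ * u) = 2 * a / (a ^ 2 + τ ^ 2) := by
  have h : (fun u : ℝ ↦ Real.exp (-(a * |u|)) * Real.cos (τ * u)) =
      fun u : ℝ ↦ (fun v : ℝ ↦ Real.exp (-(a * v)) * Real.cos (τ * v)) |u| := by
    funext u
    rcases le_or_gt 0 u with hu | hu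
    · simp only [abs_of_nonneg hu]
    · simp only [abs_of_neg hu, mul_neg, Real.cos_neg]
  rw [h, integral_comp_abs (f := fun v : ℝ ↦ Real.exp (-(a * v)) * Real.cos (τ * v)),
    integral_Ioi_exp_neg_mul_cos ha]
  ring

/-- The Lorentzian of the vertical series as a cosine transform:
`l/(l² + (τ/2)²) = ∫ e^{−2l|u|} cos(τu) du` (`l > 0`). [folklore] -/
theorem lorentz_eq_integral_cos {l : ℝ} (hl : 0 < l) (τ : ℝ) :
    l / (l ^ 2 + (τ / 2) ^ 2) = ∫ u : ℝ, Real.exp (-(2 * l * |u|)) * Real.cos (τ * u) := by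
  rw [integral_exp_neg_mul_abs_mul_cos (by positivity : 0 < 2 * l)]
  have h1 : 0 < l ^ 2 + (τ / 2) ^ 2 := by positivity
  have h2 : 0 < (2 * l) ^ 2 + τ ^ 2 := by positivity
  field_simp

/-- `e^{−a|u|}` is integrable (`a > 0`). [folklore] -/
theorem integrable_exp_neg_mul_abs {a : ℝ} (ha : 0 < a) : Integrable fun u : ℝ ↦ Real.exp (-(a * |u|)) := by
  have hIoi : IntegrableOn (fun u : ℝ ↦ Real.exp (-(a * |u|))) (Ioi 0) :=
    (exp_neg_integrableOn_Ioi 0 ha).congr_fun (fun u hu ↦ by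
      rw [abs_of_pos (show (0 : ℝ) < u from hu)]; ring_nf) measurableSet_Ioi
  have hIic : IntegrableOn (fun u : ℝ ↦ Real.exp (-(a * |u|))) (Iic 0) := by
    rw [← Measure.map_neg_eq_self (volume : Measure ℝ)]
    let m : MeasurableEmbedding fun x : ℝ ↦ -x := (Homeomorph.neg ℝ).measurableEmbedding
    rw [m.integrableOn_map_iff]
    simp_rw [Function.comp_def, abs_neg, neg_preimage, neg_Iic, neg_zero]
    exact Iff.mpr integrableOn_Ici_iff_integrableOn_Ioi hIoi
  have := hIic.union hIoi
  rwa [Iic_union_Ioi, integrableOn_univ] at this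

/-! ## The deficit in position space -/

/-- **Mellin inversion read on the cosine side**: `∫ |ĝ(1/2+iy)|² cos(yu) dy = 2π Re k(u)`, `k = g ⋆ g̃`
(`weilMellin_inversion` for the test function `k` at `c = 1/2`, `k̂(1/2+iy) = |ĝ(1/2+iy)|²`, `k(−u) = conj k(u)`).
[cite: Bombieri2000Weil, §2] -/
theorem integral_norm_sq_weilMellin_mul_cos (hg : IsWeilTest g) (u : ℝ) :
    ∫ y : ℝ, ‖weilMellin g (1 / 2 + y * I)‖ ^ 2 * Real.cos (y * u) =
      2 * π * (weilConv g (weilReflect g) u).re := by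
  set k := weilConv g (weilReflect g) with hk
  have hkt : IsWeilTest k := hg.weilConv hg.weilReflect
  have hinv := weilMellin_inversion hkt (1 / 2) (-u)
  push_cast at hinv
  simp only [sub_self, zero_mul, Complex.exp_zero, mul_one] at hinv
  -- hinv : ∫ y, k̂(1/2 + yI) * cexp(-(yI) * -u) = 2π k(-u)
  have hW : ∀ y : ℝ, weilMellin k (1 / 2 + y * I) = ((‖weilMellin g (1 / 2 + y * I)‖ ^ 2 : ℝ) : ℂ) :=
    fun y ↦ by rw [hk, weilMellin_weilConv_weilReflect_half hg y]
  have hI : Integrable fun y : ℝ ↦ weilMellin k (1 / 2 + y * I) * cexp (-(y * I) * -(u : ℂ)) := by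
    refine (integrable_norm_sq_weilMellin_half_line hg).mono' ?_ (Eventually.of_forall fun y ↦ ?_)
    · exact (((continuous_weilMellin hkt.1.continuous hkt.2).comp (by fun_prop)).mul
        (by fun_prop)).aestronglyMeasurable
    · have h0 : (-(↑y * I) * -(u : ℂ)).re = 0 := by simp
      rw [norm_mul, Complex.norm_exp, h0, Real.exp_zero, mul_one, hW y, Complex.norm_real,
        Real.norm_of_nonneg (sq_nonneg _)]
  have e1 : ∀ y : ℝ, (weilMellin k (1 / 2 + y * I) * cexp (-(y * I) * -(u : ℂ))).re =
      ‖weilMellin g (1 / 2 + y * I)‖ ^ 2 * Real.cos (y * u) := by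
    intro y
    rw [hW y, Complex.re_ofReal_mul,
      show -(↑y * I) * -(u : ℂ) = ((y * u : ℝ) : ℂ) * I by push_cast; ring, Complex.exp_ofReal_mul_I_re]
  have hre := congrArg Complex.re hinv
  have h2 := integral_re hI
  simp only [RCLike.re_to_complex] at h2
  rw [← h2] at hre
  simp_rw [e1] at hre
  rw [hre, show (2 : ℂ) * ↑π * k (-u) = ((2 * π : ℝ) : ℂ) * k (-u) by push_cast; ring, Complex.re_ofReal_mul,
    hk, weilConv_weilReflect_neg, Complex.conj_re]

/-- **THE LORENTZIAN DEFICIT IN POSITION SPACE**: for a test function `g`, `k = g ⋆ g̃` and `l > 0`,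
`∫ |ĝ(1/2+iτ)|² · l/(l² + τ²/4) dτ = 2π ∫ e^{−2l|u|} Re k(u) du` (cosine transform + Fubini + Mellin inversion).
[cite: Bombieri2000Weil, §2; MontgomeryVaughan2007, (12.22)] -/
theorem lorentz_deficit_eq_integral (hg : IsWeilTest g) {l : ℝ} (hl : 0 < l) :
    ∫ τ : ℝ, ‖weilMellin g (1 / 2 + τ * I)‖ ^ 2 * (l / (l ^ 2 + (τ / 2) ^ 2)) =
      2 * π * ∫ u : ℝ, Real.exp (-(2 * l * |u|)) * (weilConv g (weilReflect g) u).re := by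
  set W : ℝ → ℝ := fun τ ↦ ‖weilMellin g (1 / 2 + τ * I)‖ ^ 2 with hW
  set E : ℝ → ℝ := fun u ↦ Real.exp (-(2 * l * |u|)) with hE
  have hWi : Integrable W := integrable_norm_sq_weilMellin_half_line hg
  have hEi : Integrable E := integrable_exp_neg_mul_abs (by positivity)
  have hWc : Continuous W := continuous_norm_sq_weilMellin_half_line hg
  -- joint integrability of `(τ, u) ↦ W(τ) E(u) cos(τu)`
  have hF : Integrable (Function.uncurry fun τ u : ℝ ↦ W τ * (E u * Real.cos (τ * u))) (volume.prod volume) := by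
    refine (hWi.mul_prod hEi).mono' ?_ (Eventually.of_forall ?_)
    · have hm : Continuous (Function.uncurry fun τ u : ℝ ↦ W τ * (E u * Real.cos (τ * u))) := by
        refine (hWc.comp continuous_fst).mul ((?_ : Continuous fun p : ℝ × ℝ ↦ E p.2).mul ?_)
        · exact (Real.continuous_exp.comp ((continuous_const.mul (continuous_abs.comp continuous_snd)).neg))
        · exact Real.continuous_cos.comp (continuous_fst.mul continuous_snd)
      exact hm.aestronglyMeasurable
    · rintro ⟨τ, u⟩
      simp only [Function.uncurry_apply_pair]
      rw [norm_mul, norm_mul, Real.norm_of_nonneg (sq_nonneg _), Real.norm_of_nonneg (Real.exp_pos _).le]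
      have h0 : 0 ≤ W τ * E u := mul_nonneg (sq_nonneg _) (Real.exp_pos _).le
      calc W τ * (E u * ‖Real.cos (τ * u)‖) ≤ W τ * (E u * 1) := by
            refine mul_le_mul_of_nonneg_left (mul_le_mul_of_nonneg_left (Real.abs_cos_le_one _)
              (Real.exp_pos _).le) (sq_nonneg _)
        _ = W τ * E u := by ring
  calc ∫ τ : ℝ, W τ * (l / (l ^ 2 + (τ / 2) ^ 2))
      = ∫ τ : ℝ, ∫ u : ℝ, W τ * (E u * Real.cos (τ * u)) := by
        refine integral_congr_ae (Eventually.of_forall fun τ ↦ ?_)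
        simp only
        rw [lorentz_eq_integral_cos hl, ← integral_const_mul]
    _ = ∫ u : ℝ, ∫ τ : ℝ, W τ * (E u * Real.cos (τ * u)) := integral_integral_swap hF
    _ = ∫ u : ℝ, E u * (2 * π * (weilConv g (weilReflect g) u).re) := by
        refine integral_congr_ae (Eventually.of_forall fun u ↦ ?_)
        simp only
        rw [← integral_norm_sq_weilMellin_mul_cos hg u, ← integral_const_mul]
        refine integral_congr_ae (Eventually.of_forall fun τ ↦ ?_)
        simp only
        ring
    _ = 2 * π * ∫ u : ℝ, E u * (weilConv g (weilReflect g) u).re := by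
        rw [← integral_const_mul]
        refine integral_congr_ae (Eventually.of_forall fun u ↦ ?_)
        simp only
        ring

/-! ## The window integral of `e^{−a|u|}` -/

/-- `∫_0^L e^{−av} dv = (1 − e^{−aL})/a`. [folklore] -/
theorem integral_exp_neg_mul_zero_to {a : ℝ} (ha : 0 < a) (L : ℝ) :
    ∫ v in (0 : ℝ)..L, Real.exp (-(a * v)) = (1 - Real.exp (-(a * L))) / a := by
  have hc : (-a) ≠ 0 := neg_ne_zero.2 ha.ne'
  have h := intervalIntegral.integral_comp_mul_left Real.exp hc (a := 0) (b := L)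
  have e : (fun v : ℝ ↦ Real.exp (-(a * v))) = fun v : ℝ ↦ Real.exp (-a * v) := by
    funext v; ring_nf
  rw [e, h, integral_exp, smul_eq_mul]
  simp only [mul_zero, Real.exp_zero]
  field_simp
  ring

/-- `∫_{c−t}^{c+t} e^{−a|u|} du = (2 − e^{−a(t−c)} − e^{−a(t+c)})/a` for `|c| < t`. [folklore] -/
theorem integral_exp_neg_mul_abs_window {a t c : ℝ} (ha : 0 < a) (hc : -t < c ∧ c < t) :
    ∫ u in (c - t)..(c + t), Real.exp (-(a * |u|)) =
      (2 - Real.exp (-(a * (t - c))) - Real.exp (-(a * (t + c)))) / a := by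
  have hcont : Continuous fun u : ℝ ↦ Real.exp (-(a * |u|)) := by fun_prop
  rw [← intervalIntegral.integral_add_adjacent_intervals (b := 0) (hcont.intervalIntegrable _ _)
    (hcont.intervalIntegrable _ _)]
  -- left half: `u ≤ 0`, substitute `u = -v`
  have hL : ∫ u in (c - t)..0, Real.exp (-(a * |u|)) = ∫ v in (0 : ℝ)..(t - c), Real.exp (-(a * v)) := by
    have h := intervalIntegral.integral_comp_neg (a := (0 : ℝ)) (b := t - c) (fun v : ℝ ↦ Real.exp (-(a * |v|)))
    -- h : ∫ x in 0..(t-c), e^{-a|-x|} = ∫ x in -(t-c)..-0, e^{-a|x|}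
    rw [neg_zero, show -(t - c) = c - t by ring] at h
    rw [← h]
    refine intervalIntegral.integral_congr fun v hv ↦ ?_
    rw [uIcc_of_le (by linarith [hc.2])] at hv
    simp only [abs_neg, abs_of_nonneg hv.1]
  -- right half: `u ≥ 0`
  have hR : ∫ u in (0 : ℝ)..(c + t), Real.exp (-(a * |u|)) = ∫ v in (0 : ℝ)..(t + c), Real.exp (-(a * v)) := by
    rw [show c + t = t + c by ring]
    refine intervalIntegral.integral_congr fun v hv ↦ ?_
    rw [uIcc_of_le (by linarith [hc.1])] at hv
    simp only [abs_of_nonneg hv.1]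
  rw [hL, hR, integral_exp_neg_mul_zero_to ha, integral_exp_neg_mul_zero_to ha]
  field_simp
  ring

/-- **The centred window is the largest**: for `|y| < t`, `a > 0`,
`∫ e^{−a|u|} 1_{(−t,t)}(y − u) du ≤ (2/a)(1 − e^{−at})` (the window is `(y − t, y + t)`, its integral is
`(2 − e^{−a(t−y)} − e^{−a(t+y)})/a`, and `e^{ay} + e^{−ay} ≥ 2`). [folklore] -/
theorem integral_exp_neg_mul_abs_indicator_le {a t y : ℝ} (ha : 0 < a) (hy : -t < y ∧ y < t) :
    ∫ u : ℝ, Real.exp (-(a * |u|)) * (Ioo (-t) t).indicator (fun _ ↦ (1 : ℝ)) (y - u) ≤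
      2 / a * (1 - Real.exp (-(a * t))) := by
  have e1 : (fun u : ℝ ↦ Real.exp (-(a * |u|)) * (Ioo (-t) t).indicator (fun _ ↦ (1 : ℝ)) (y - u)) =
      (Ioo (y - t) (y + t)).indicator (fun u ↦ Real.exp (-(a * |u|))) := by
    funext u
    by_cases hu : u ∈ Ioo (y - t) (y + t)
    · have hyu : y - u ∈ Ioo (-t) t := ⟨by linarith [hu.2], by linarith [hu.1]⟩
      rw [indicator_of_mem hyu, indicator_of_mem hu, mul_one]
    · have hyu : y - u ∉ Ioo (-t) t := fun h ↦ hu ⟨by linarith [h.2], by linarith [h.1]⟩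
      rw [indicator_of_notMem hyu, indicator_of_notMem hu, mul_zero]
  rw [e1, integral_indicator measurableSet_Ioo, ← integral_Ioc_eq_integral_Ioo,
    ← intervalIntegral.integral_of_le (by linarith [hy.1, hy.2]),
    integral_exp_neg_mul_abs_window ha hy]
  -- `(2 − p − q)/a ≤ (2 − 2r)/a` with `p + q ≥ 2r`, `r = e^{−at}`, `p q = r²`
  have hsum : 2 * Real.exp (-(a * t)) ≤ Real.exp (-(a * (t - y))) + Real.exp (-(a * (t + y))) := by
    have ep : Real.exp (-(a * (t - y))) = Real.exp (-(a * t)) * Real.exp (a * y) := by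
      rw [← Real.exp_add]; ring_nf
    have eq : Real.exp (-(a * (t + y))) = Real.exp (-(a * t)) * Real.exp (-(a * y)) := by
      rw [← Real.exp_add]; ring_nf
    rw [ep, eq, ← mul_add]
    have hcosh : 2 ≤ Real.exp (a * y) + Real.exp (-(a * y)) := by
      have := Real.one_le_cosh (a * y)
      rw [Real.cosh_eq] at this
      linarith
    have hr : 0 < Real.exp (-(a * t)) := Real.exp_pos _
    nlinarith
  rw [div_le_iff₀ ha]
  field_simp
  nlinarith

end UniformFloor

end Summit.Ventures.WeilGRH

end
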